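import Mathlib
import Summits.NavierStokesRegularity.NavierStokesRegularity.Theorems.EulerZoomLiouvillePowerGaugeEulerLiouvilleInflowTrajectory
import Summits.NavierStokesRegularity.NavierStokesRegularity.Theorems.EulerZoomLiouvillePowerGaugeEulerLiouvilleForwardEscapeTools
import Summits.NavierStokesRegularity.NavierStokesRegularity.Theorems.EulerZoomLiouvillePowerGaugeEulerLiouvilleMeanDisplacement
import HarnessLib

/-!
# Crux `EulerZoomLiouville.PowerGaugeEulerLiouville` (stmt-NavierStokesRegularity-19832): THE INFLOW LAW — plate t59-IN of nsreg-p2 ROUND-54 «THE TRACE»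

Width/portrait piece for THE ONE STATEMENT `stub_selfSimilarC2Needle` (LEAD skeleton `Cruxes/PowerGaugeEulerLiouville/Lines/birth.lean` v111,
ns-typeII-p2 g16), `--supports stmt-NavierStokesRegularity-19832 --as helper`.  Text = nsreg-p2 g44's `NsregP2.R54.Trace.InflowLaw ρ V`
(`r54/Sketch54.lean` sha16 f78682d2f4ee3f27) VERBATIM with `simFlow` unfolded, for `−2 < ρ ≤ 1` (keys 09:01:11Z / 09:04:21Z).

THE BACKWARD TWIN OF THE ESCAPE LAW.  In the A-gauge and the cut-off idiom (`V′ ∈ C²`, `‖DV′‖ ≤ K`, `V′ = V` on `ball 0 Rbig`, flow `Ψ_s` of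
`γy + V′`, `γ = 1/(2+ρ)`): for `L ≥ 8`, `S ≥ 0`, `Le^{γS} < Rbig`, the positions `y` of physical radius `≤ 2` at similarity time `S`
(`‖y‖ ≤ 2e^{γS}`) whose backward orbit `Ψ_{−σ}y` had physical radius `≥ L/2` at some earlier time `S − σ` have volume
`≤ 32A·L^{−(1+2ρ)}·e^{3γS}` — in fact `≤ 2^{3+2ρ}A L^{−(1+2ρ)}e^{3γS}` (`inflowLaw`).  Proof: `y = Ψ_S z` for the label `z = Ψ_{−S}y` (group law), so
the backward orbit is the FORWARD trajectory of `z`, whose physical radius falls from `≥ D = L/2` to `≤ 2 ≤ D/2`: every such trajectory pays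
`(D/2)² ≤ ∫_0^S 𝟙{radius ≤ D on [t,S]} e^{(1−2γ)t}‖V′(Ψ_t z)‖²dt` (`Trace.sq_le_lintegral_inflow`); Chebyshev over the positions, Tonelli, and at
each time `t` the positions whose orbit stays below `D` on `[t, S]` are `Ψ_{S−t}`-images of forward-staying points in `B̄(0, De^{γt})`, so the
area formula with Jacobian `e^{3γ(S−t)}` (`Trace.lintegral_comp_flow_section_eq`) and the A-gauge (`Trace.lintegral_closedBall_normSq_le_of_gauge`,
ns-ezl-w3) bound the slice by `A D^{1−2ρ}e^{3γS}e^{−t}` (`inflow_bookkeeping`: `(1−2γ) − 3γ + γ(1−2ρ) = −1`); `∫_0^S e^{−t} ≤ 1`.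

HONEST FRAMING: a portrait instrument about HYPOTHETICAL profiles; nothing about the crux E (19832 OPEN) or NS regularity is proved.
[nsreg-p2 R54 §C t59-IN; cite: ConstantinIgnatovaVicol2026Putative, §3.4.1 eq. (3.21)–(3.22), §3.5]
-/

noncomputable section

set_option linter.dupNamespace false

open MeasureTheory Set Filter Topology Metric Function
open scoped RealInnerProductSpace NNReal ENNReal ContDiff

namespace Summit.NavierStokesRegularity.NavierStokesRegularity.Theorems.PowerGaugeEulerLiouville.Trace

open Literature.Analysis Literature.Analysis.FluidPDE
open Summit.NavierStokesRegularity.NavierStokesRegularity.Theorems.PowerGaugeEulerLiouville.BernoulliLandscape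
open Summit.NavierStokesRegularity.NavierStokesRegularity.Theorems.PowerGaugeEulerLiouville.NeedleFeeding

/-- **The exponent identity `(1−2γ) − 3γ + γ(1−2ρ) = −1` run backwards from the horizon** (`γ = 1/(2+ρ)`):
`e^{3γ(S−t)}·e^{(1−2γ)t}·A(De^{γt})^{1−2ρ} = A D^{1−2ρ} e^{3γS} e^{−t}`. [folklore] -/
theorem inflow_bookkeeping {ρ A D S t : ℝ} (h2ρ : 0 < 2 + ρ) (hD : 0 ≤ D) :
    Real.exp (3 * (1 / (2 + ρ)) * (S - t)) * (Real.exp ((1 - 2 * (1 / (2 + ρ))) * t) *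
        (A * (D * Real.exp (1 / (2 + ρ) * t)) ^ (1 - 2 * ρ))) =
      A * D ^ (1 - 2 * ρ) * Real.exp (3 * (1 / (2 + ρ)) * S) * Real.exp (-t) := by
  rw [Real.mul_rpow hD (Real.exp_pos _).le, ← Real.exp_mul]
  have e : 3 * (1 / (2 + ρ)) * (S - t) + ((1 - 2 * (1 / (2 + ρ))) * t + 1 / (2 + ρ) * t * (1 - 2 * ρ)) =
      3 * (1 / (2 + ρ)) * S + -t := by
    field_simp
    ring
  calc Real.exp (3 * (1 / (2 + ρ)) * (S - t)) * (Real.exp ((1 - 2 * (1 / (2 + ρ))) * t) *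
        (A * (D ^ (1 - 2 * ρ) * Real.exp (1 / (2 + ρ) * t * (1 - 2 * ρ)))))
      = A * D ^ (1 - 2 * ρ) * (Real.exp (3 * (1 / (2 + ρ)) * (S - t)) *
          (Real.exp ((1 - 2 * (1 / (2 + ρ))) * t) * Real.exp (1 / (2 + ρ) * t * (1 - 2 * ρ)))) := by ring
    _ = A * D ^ (1 - 2 * ρ) * Real.exp (3 * (1 / (2 + ρ)) * S) * Real.exp (-t) := by
        rw [← Real.exp_add, ← Real.exp_add, e, Real.exp_add]; ring

/-- The constant: `4A(L/2)^{−(1+2ρ)} ≤ 32A L^{−(1+2ρ)}` for `A ≥ 0`, `L > 0`, `ρ ≤ 1` (`2^{1+2ρ} ≤ 8`). [folklore] -/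
theorem inflow_constant {ρ A L : ℝ} (hρ1 : ρ ≤ 1) (hA : 0 ≤ A) (hL : 0 < L) :
    4 * A * (L / 2) ^ (-(1 + 2 * ρ)) ≤ 32 * A * L ^ (-(1 + 2 * ρ)) := by
  rw [Real.div_rpow hL.le (by norm_num : (0 : ℝ) ≤ 2), Real.rpow_neg (by norm_num : (0 : ℝ) ≤ 2), div_inv_eq_mul]
  have h8 : (2 : ℝ) ^ (1 + 2 * ρ) ≤ 8 := by
    calc (2 : ℝ) ^ (1 + 2 * ρ) ≤ (2 : ℝ) ^ (3 : ℝ) := Real.rpow_le_rpow_of_exponent_le (by norm_num) (by linarith)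
      _ = 8 := by norm_num
  have hLr : 0 ≤ L ^ (-(1 + 2 * ρ)) := Real.rpow_nonneg hL.le _
  calc 4 * A * (L ^ (-(1 + 2 * ρ)) * (2 : ℝ) ^ (1 + 2 * ρ)) = 4 * (2 : ℝ) ^ (1 + 2 * ρ) * (A * L ^ (-(1 + 2 * ρ))) := by ring
    _ ≤ 4 * 8 * (A * L ^ (-(1 + 2 * ρ))) := by gcongr
    _ = 32 * A * L ^ (-(1 + 2 * ρ)) := by ring

/-- ★ **THE INFLOW LAW (t59-IN, `NsregP2.R54.Trace.InflowLaw ρ V` VERBATIM, `−2 < ρ ≤ 1`).**  In the A-gauge and the cut-off idiom, for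
`L ≥ 8`, `S ≥ 0`, `Le^{S/(2+ρ)} < Rbig`: the positions of physical radius `≤ 2` at similarity time `S` whose backward trajectory reached physical
radius `≥ L/2` at some time in `[0, S]` have volume `≤ 32A·L^{−(1+2ρ)}·e^{3S/(2+ρ)}` (label volume × Jacobian).  Group law ⇒ forward trajectories of
`z = Ψ_{−S}y`; per trajectory `(L/4)² ≤ ∫𝟙_{stay on [t,S]}e^{(1−2γ)t}‖V′‖²` (`sq_le_lintegral_inflow`); Chebyshev, Tonelli, area formula with Jacobian
`e^{3γ(S−t)}` on `Ψ_{S−t}`-preimages inside `B̄(0,(L/2)e^{γt})`, A-gauge, `(1−2γ)−3γ+γ(1−2ρ) = −1`, `∫_0^S e^{−t} ≤ 1`, `2^{1+2ρ} ≤ 8`.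
[nsreg-p2 R54 §C t59-IN; cite: ConstantinIgnatovaVicol2026Putative, §3.4.1 eq. (3.21)–(3.22), §3.5] -/
theorem inflowLaw {ρ : ℝ} (hρ : -2 < ρ) (hρ1 : ρ ≤ 1) (V : EuclideanSpace ℝ (Fin 3) → EuclideanSpace ℝ (Fin 3)) :
    ∀ P : EuclideanSpace ℝ (Fin 3) → ℝ, IsSelfSimilarEulerProfile (1 / (2 + ρ)) 0 V P →
    ∀ A : ℝ, (∀ R : ℝ, 1 ≤ R → ∫ y in ball (0 : EuclideanSpace ℝ (Fin 3)) R, ‖V y‖ ^ 2 ≤ A * R ^ (1 - 2 * ρ)) →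
    ∀ (L S : ℝ) (V' : EuclideanSpace ℝ (Fin 3) → EuclideanSpace ℝ (Fin 3)) (K Rbig : ℝ), 8 ≤ L → 0 ≤ S → ContDiff ℝ 2 V' →
      (∀ y, ‖fderiv ℝ V' y‖ ≤ K) → L * Real.exp (S / (2 + ρ)) < Rbig →
      (∀ w ∈ ball (0 : EuclideanSpace ℝ (Fin 3)) Rbig, V' w = V w) →
      (volume {y ∈ closedBall (0 : EuclideanSpace ℝ (Fin 3)) (2 * Real.exp (S / (2 + ρ))) |
          ∃ σ ∈ Icc 0 S, L / 2 * Real.exp ((S - σ) / (2 + ρ)) ≤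
            ‖ODE.evolutionMap (fun _ : ℝ => selfSimilarTransport (1 / (2 + ρ)) (0 : EuclideanSpace ℝ (Fin 3)) V') 0 (-σ) y‖}).toReal ≤
        32 * A * L ^ (-(1 + 2 * ρ)) * Real.exp (3 * S / (2 + ρ)) := by
  intro P hprof A hA L S V' K Rbig hL hS hV' hK hRbig hVV'
  have h2ρ : 0 < 2 + ρ := by linarith
  have hV1 : ContDiff ℝ 1 V' := hV'.of_le (by norm_num)
  set γ : ℝ := 1 / (2 + ρ) with hγ
  set D : ℝ := L / 2 with hDdef
  have hD4 : 4 ≤ D := by rw [hDdef]; linarith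
  have hD0 : 0 < D := by linarith
  have hL0 : 0 < L := by linarith
  have hA0 : 0 ≤ A := by
    have h := hA 1 le_rfl
    have h0 : 0 ≤ ∫ y in ball (0 : EuclideanSpace ℝ (Fin 3)) 1, ‖V y‖ ^ 2 := integral_nonneg fun y => sq_nonneg _
    simp only [Real.one_rpow, mul_one] at h
    linarith
  obtain ⟨Φ, hΦ⟩ : ∃ Φ : ℝ → EuclideanSpace ℝ (Fin 3) → EuclideanSpace ℝ (Fin 3),
      Φ = ODE.evolutionMap (fun _ : ℝ => selfSimilarTransport γ (0 : EuclideanSpace ℝ (Fin 3)) V') 0 := ⟨_, rfl⟩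
  rw [← hΦ]
  have eγ : ∀ σ : ℝ, Real.exp (γ * σ) = Real.exp (σ / (2 + ρ)) := fun σ => by rw [hγ]; congr 1; ring
  have hflow : ∀ (a b : ℝ) (w : EuclideanSpace ℝ (Fin 3)), Φ (a + b) w = Φ a (Φ b w) := fun a b w => by
    rw [hΦ]; exact C2.Kelvin.flow_add (γ := γ) hV1 hK a b w
  have hΦ0 : ∀ w : EuclideanSpace ℝ (Fin 3), Φ 0 w = w := fun w => by rw [hΦ]; exact ODE.evolutionMap_self _ 0 w
  -- radii: `R = De^{γS} < Rbig`, `V′ = V` and `div V′ = 0` on `‖w‖ ≤ R`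
  set R : ℝ := D * Real.exp (γ * S) with hR
  have hRbig' : R < Rbig := by
    have : L * Real.exp (γ * S) < Rbig := by rw [eγ]; exact hRbig
    have hpos : 0 < Real.exp (γ * S) := Real.exp_pos _
    rw [hR, hDdef]; nlinarith
  have hVeq : ∀ w : EuclideanSpace ℝ (Fin 3), ‖w‖ ≤ R → V' w = V w := fun w hw =>
    hVV' w (by rw [mem_ball_zero_iff]; exact lt_of_le_of_lt hw hRbig')
  have hdiv : ∀ w : EuclideanSpace ℝ (Fin 3), ‖w‖ ≤ R → VectorCalculus.divergence V' w = 0 := by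
    intro w hw
    have hwB : w ∈ ball (0 : EuclideanSpace ℝ (Fin 3)) Rbig := by
      rw [mem_ball_zero_iff]; exact lt_of_le_of_lt hw hRbig'
    have hEq : V' =ᶠ[𝓝 w] V := Filter.eventually_of_mem (isOpen_ball.mem_nhds hwB) fun w' hw' => hVV' w' hw'
    have h0 := hprof.divFree w
    unfold VectorCalculus.divergence at h0 ⊢
    rw [hEq.fderiv_eq]; exact h0
  have hVc : Continuous V := hprof.contDiff_velocity.continuous
  -- the integrand on `labels × time` and the label functional `J`, pulled back to positions `I y = J (Ψ_{−S} y)`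
  obtain ⟨T, hT⟩ : ∃ T : Set (EuclideanSpace ℝ (Fin 3) × ℝ),
      T = {p | ∀ τ ∈ Icc p.2 S, ‖Φ τ p.1‖ ≤ D * Real.exp (γ * τ)} := ⟨_, rfl⟩
  have hTm : MeasurableSet T := by
    rw [hT, hΦ]
    exact measurableSet_stayUntilProd_of_continuous
      (Θ := fun z τ => ODE.evolutionMap (fun _ : ℝ => selfSimilarTransport γ (0 : EuclideanSpace ℝ (Fin 3)) V') 0 τ z)
      ((continuous_flow_uncurry (γ := γ) hV' hK).comp (continuous_snd.prodMk continuous_fst))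
      (f := fun τ => D * Real.exp (γ * τ)) (by fun_prop) S
  obtain ⟨H, hH⟩ : ∃ H : EuclideanSpace ℝ (Fin 3) × ℝ → ℝ≥0∞,
      H = fun p => ENNReal.ofReal (Real.exp ((1 - 2 * γ) * p.2)) * ‖V' (Φ p.2 p.1)‖ₑ ^ 2 := ⟨_, rfl⟩
  have hHm : Measurable H := by
    rw [hH, hΦ]
    refine (ENNReal.measurable_ofReal.comp (by fun_prop : Measurable fun p : EuclideanSpace ℝ (Fin 3) × ℝ =>
      Real.exp ((1 - 2 * γ) * p.2))).mul ?_
    exact (hV'.continuous.comp ((continuous_flow_uncurry (γ := γ) hV' hK).comp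
      (continuous_snd.prodMk continuous_fst))).measurable.enorm.pow_const 2
  have hFm : Measurable (T.indicator H) := hHm.indicator hTm
  have hΦSc : Continuous (Φ (-S)) := by rw [hΦ]; exact (C2.Kelvin.contDiff_flow (γ := γ) hV' hK (-S)).continuous
  obtain ⟨F2, hF2⟩ : ∃ F2 : EuclideanSpace ℝ (Fin 3) × ℝ → ℝ≥0∞, F2 = fun p => T.indicator H (Φ (-S) p.1, p.2) := ⟨_, rfl⟩
  have hF2m : Measurable F2 := by
    rw [hF2]
    exact hFm.comp ((hΦSc.measurable.comp measurable_fst).prodMk measurable_snd)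
  obtain ⟨I, hI⟩ : ∃ I : EuclideanSpace ℝ (Fin 3) → ℝ≥0∞, I = fun y => ∫⁻ t in Icc 0 S, F2 (y, t) := ⟨_, rfl⟩
  have hIm : Measurable I := by
    rw [hI]
    exact hF2m.lintegral_prod_right'
  -- every inflowing position pays `(D/2)²`
  set ε : ℝ≥0∞ := ENNReal.ofReal ((D / 2) ^ 2) with hε
  have hε0 : ε ≠ 0 := by
    rw [hε, Ne, ENNReal.ofReal_eq_zero, not_le]; positivity
  set Y₀ : Set (EuclideanSpace ℝ (Fin 3)) := closedBall (0 : EuclideanSpace ℝ (Fin 3)) (2 * Real.exp (S / (2 + ρ))) with hY₀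
  have hin : {y ∈ Y₀ | ∃ σ ∈ Icc 0 S, L / 2 * Real.exp ((S - σ) / (2 + ρ)) ≤ ‖Φ (-σ) y‖} ⊆ {y | ε ≤ I y} ∩ Y₀ := by
    rintro y ⟨hyY, σ, hσ, hσy⟩
    refine ⟨?_, hyY⟩
    -- the label `z = Ψ_{−S} y` and its forward trajectory `Ψ_t z = Ψ_{t−S} y`
    set z : EuclideanSpace ℝ (Fin 3) := Φ (-S) y with hz
    have htraj : ∀ t : ℝ, Φ t z = Φ (t - S) y := fun t => by rw [hz, ← hflow, sub_eq_add_neg]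
    have hend : ‖Φ S z‖ ≤ D / 2 * Real.exp (γ * S) := by
      rw [htraj, sub_self, hΦ0, eγ]
      rw [hY₀, mem_closedBall_zero_iff] at hyY
      have : 2 ≤ D / 2 := by linarith
      nlinarith [Real.exp_pos (S / (2 + ρ))]
    have hfar : ∃ t ∈ Icc 0 S, D * Real.exp (γ * t) ≤ ‖Φ t z‖ := by
      refine ⟨S - σ, ⟨by linarith [hσ.2], by linarith [hσ.1]⟩, ?_⟩
      rw [htraj, show S - σ - S = -σ by ring, eγ, hDdef]
      exact hσy
    have htr := sq_le_lintegral_inflow (γ := γ) (S := S) hV' hK hD0 (z := z) (by rw [← hΦ]; exact hend)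
      (by rw [← hΦ]; exact hfar)
    rw [← hΦ] at htr
    rw [mem_setOf_eq, hI]
    refine htr.trans (le_of_eq (lintegral_congr fun t => ?_))
    rw [hF2]
    simp only
    rw [← hz]
    by_cases h : ∀ τ ∈ Icc t S, ‖Φ τ z‖ ≤ D * Real.exp (γ * τ)
    · rw [indicator_of_mem (show t ∈ {t' : ℝ | ∀ τ ∈ Icc t' S, ‖Φ τ z‖ ≤ D * Real.exp (γ * τ)} from h),
        indicator_of_mem (show (z, t) ∈ T from by rw [hT]; exact h), hH]
    · rw [indicator_of_notMem (show t ∉ {t' : ℝ | ∀ τ ∈ Icc t' S, ‖Φ τ z‖ ≤ D * Real.exp (γ * τ)} from h),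
        indicator_of_notMem (show (z, t) ∉ T from by rw [hT]; exact h)]
  -- Chebyshev on `Y₀`
  have hcheb := mul_meas_ge_le_lintegral₀ (μ := volume.restrict Y₀) hIm.aemeasurable ε
  have hvol : volume {y ∈ Y₀ | ∃ σ ∈ Icc 0 S, L / 2 * Real.exp ((S - σ) / (2 + ρ)) ≤ ‖Φ (-σ) y‖} ≤
      (volume.restrict Y₀) {y | ε ≤ I y} := by
    rw [Measure.restrict_apply (measurableSet_le measurable_const hIm)]
    exact measure_mono hin
  -- Tonelli
  have hTon : ∫⁻ y in Y₀, I y = ∫⁻ t in Icc 0 S, ∫⁻ y in Y₀, F2 (y, t) := by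
    rw [hI]
    exact lintegral_lintegral_swap (f := fun y t => F2 (y, t)) hF2m.aemeasurable
  -- the slice bound at a fixed time `t`
  have hslice : ∀ t ∈ Icc (0 : ℝ) S, ∫⁻ y in Y₀, F2 (y, t) ≤
      ENNReal.ofReal (A * D ^ (1 - 2 * ρ) * Real.exp (3 * (1 / (2 + ρ)) * S) * Real.exp (-t)) := by
    intro t ht
    -- the forward-staying preimages
    obtain ⟨Ft, hFt⟩ : ∃ Ft : Set (EuclideanSpace ℝ (Fin 3)),
        Ft = {w | ∀ u ∈ Icc 0 (S - t), ‖Φ u w‖ ≤ D * Real.exp (γ * (t + u))} := ⟨_, rfl⟩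
    have hFtm : MeasurableSet Ft := by
      rw [hFt, hΦ]
      exact (isClosed_forwardStay_fun (γ := γ) hV' hK (S - t) (fun u => D * Real.exp (γ * (t + u)))).measurableSet
    have hstayFt : ∀ w ∈ Ft, ∀ u ∈ Icc 0 (S - t), ‖Φ u w‖ ≤ R := by
      intro w hw u hu
      rw [hFt] at hw
      refine (hw u hu).trans ?_
      rw [hR]
      exact mul_le_mul_of_nonneg_left (Real.exp_le_exp.2 (by nlinarith [hu.2, h2ρ, show 0 < γ from by rw [hγ]; positivity]))
        hD0.le
    have hFtball : Ft ⊆ closedBall (0 : EuclideanSpace ℝ (Fin 3)) (D * Real.exp (γ * t)) := by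
      intro w hw
      rw [hFt] at hw
      rw [mem_closedBall_zero_iff]
      have := hw 0 ⟨le_rfl, by linarith [ht.2]⟩
      rwa [hΦ0, add_zero] at this
    -- positions whose orbit stays below `D` on `[t, S]` are `Ψ_{S−t}`-images of `Ft`
    have hsub : {y : EuclideanSpace ℝ (Fin 3) | (Φ (-S) y, t) ∈ T} ⊆ Φ (S - t) '' Ft := by
      intro y hy
      rw [mem_setOf_eq, hT, mem_setOf_eq] at hy
      refine ⟨Φ (t - S) y, ?_, ?_⟩
      · rw [hFt, mem_setOf_eq]
        intro u hu
        rw [← hflow, show u + (t - S) = (t + u) - S by ring]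
        have := hy (t + u) ⟨by linarith [hu.1], by linarith [hu.2]⟩
        rwa [← hflow, show t + u + -S = (t + u) - S by ring] at this
      · rw [← hflow, show S - t + (t - S) = 0 by ring, hΦ0]
    -- measurable integrand on positions
    have hgm : Measurable fun y : EuclideanSpace ℝ (Fin 3) => H (Φ (-S) y, t) :=
      hHm.comp ((hΦSc.measurable).prodMk measurable_const)
    -- area formula with Jacobian `e^{3γ(S−t)}`
    have harea := lintegral_comp_flow_section_eq (γ := γ) hV' hK (σ := S - t) (by linarith [ht.2]) hdiv hFtm
      (by rw [hΦ] at hstayFt; exact hstayFt) (g := fun y => H (Φ (-S) y, t)) (by rw [hΦ] at hgm ⊢; exact hgm)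
    rw [← hΦ] at harea
    have hcomp : ∀ w : EuclideanSpace ℝ (Fin 3), H (Φ (-S) (Φ (S - t) w), t) =
        ENNReal.ofReal (Real.exp ((1 - 2 * γ) * t)) * ‖V' w‖ₑ ^ 2 := fun w => by
      have h1 : Φ (-S) (Φ (S - t) w) = Φ (-t) w := by rw [← hflow]; congr 1; ring
      have h2 : Φ t (Φ (-t) w) = w := by rw [← hflow, show t + -t = 0 by ring, hΦ0]
      rw [hH]
      simp only
      rw [h1, h2]
    simp_rw [hcomp] at harea
    -- assemble the slice
    calc ∫⁻ y in Y₀, F2 (y, t) ≤ ∫⁻ y, F2 (y, t) := setLIntegral_le_lintegral _ _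
      _ = ∫⁻ y, {y : EuclideanSpace ℝ (Fin 3) | (Φ (-S) y, t) ∈ T}.indicator (fun y => H (Φ (-S) y, t)) y := by
          refine lintegral_congr fun y => ?_
          rw [hF2]
          show T.indicator H (Φ (-S) y, t) = _
          by_cases h : (Φ (-S) y, t) ∈ T
          · rw [indicator_of_mem h, indicator_of_mem (show y ∈ {y : EuclideanSpace ℝ (Fin 3) | (Φ (-S) y, t) ∈ T} from h)]
          · rw [indicator_of_notMem h,
              indicator_of_notMem (show y ∉ {y : EuclideanSpace ℝ (Fin 3) | (Φ (-S) y, t) ∈ T} from h)]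
      _ ≤ ∫⁻ y in {y : EuclideanSpace ℝ (Fin 3) | (Φ (-S) y, t) ∈ T}, H (Φ (-S) y, t) := lintegral_indicator_le _ _
      _ ≤ ∫⁻ y in Φ (S - t) '' Ft, H (Φ (-S) y, t) := lintegral_mono_set hsub
      _ = ENNReal.ofReal (Real.exp (3 * γ * (S - t))) *
            ∫⁻ w in Ft, ENNReal.ofReal (Real.exp ((1 - 2 * γ) * t)) * ‖V' w‖ₑ ^ 2 := harea.symm
      _ = ENNReal.ofReal (Real.exp (3 * γ * (S - t))) * (ENNReal.ofReal (Real.exp ((1 - 2 * γ) * t)) *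
            ∫⁻ w in Ft, ‖V' w‖ₑ ^ 2) := by rw [lintegral_const_mul' _ _ ENNReal.ofReal_ne_top]
      _ ≤ ENNReal.ofReal (Real.exp (3 * γ * (S - t))) * (ENNReal.ofReal (Real.exp ((1 - 2 * γ) * t)) *
            ENNReal.ofReal (A * (D * Real.exp (γ * t)) ^ (1 - 2 * ρ))) := by
          gcongr
          calc ∫⁻ w in Ft, ‖V' w‖ₑ ^ 2 ≤ ∫⁻ w in closedBall (0 : EuclideanSpace ℝ (Fin 3)) (D * Real.exp (γ * t)), ‖V' w‖ₑ ^ 2 :=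
                lintegral_mono_set hFtball
            _ = ∫⁻ w in closedBall (0 : EuclideanSpace ℝ (Fin 3)) (D * Real.exp (γ * t)), ‖V w‖ₑ ^ 2 := by
                refine setLIntegral_congr_fun measurableSet_closedBall (fun w hw => ?_)
                rw [mem_closedBall_zero_iff] at hw
                rw [hVeq w (hw.trans (by
                  rw [hR]
                  exact mul_le_mul_of_nonneg_left (Real.exp_le_exp.2 (by
                    nlinarith [ht.2, show 0 < γ from by rw [hγ]; positivity])) hD0.le))]
            _ ≤ ENNReal.ofReal (A * (D * Real.exp (γ * t)) ^ (1 - 2 * ρ)) :=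
                lintegral_closedBall_normSq_le_of_gauge (ρ := ρ) hVc hA (by nlinarith [Real.one_le_exp (show 0 ≤ γ * t from by
                  have : 0 < γ := by rw [hγ]; positivity
                  nlinarith [ht.1])])
      _ = ENNReal.ofReal (A * D ^ (1 - 2 * ρ) * Real.exp (3 * (1 / (2 + ρ)) * S) * Real.exp (-t)) := by
          rw [← ENNReal.ofReal_mul (Real.exp_pos _).le, ← ENNReal.ofReal_mul (Real.exp_pos _).le, hγ,
            inflow_bookkeeping h2ρ hD0.le]
  have htot : ∫⁻ y in Y₀, I y ≤ ENNReal.ofReal (A * D ^ (1 - 2 * ρ) * Real.exp (3 * (1 / (2 + ρ)) * S)) := by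
    rw [hTon]
    calc ∫⁻ t in Icc 0 S, ∫⁻ y in Y₀, F2 (y, t)
        ≤ ∫⁻ t in Icc 0 S, ENNReal.ofReal (A * D ^ (1 - 2 * ρ) * Real.exp (3 * (1 / (2 + ρ)) * S) * Real.exp (-t)) :=
          setLIntegral_mono' measurableSet_Icc hslice
      _ = ENNReal.ofReal (A * D ^ (1 - 2 * ρ) * Real.exp (3 * (1 / (2 + ρ)) * S)) *
            ∫⁻ t in Icc 0 S, ENNReal.ofReal (Real.exp (-t)) := by
          rw [← lintegral_const_mul' _ _ ENNReal.ofReal_ne_top]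
          refine lintegral_congr fun t => ?_
          rw [← ENNReal.ofReal_mul (by positivity)]
      _ ≤ ENNReal.ofReal (A * D ^ (1 - 2 * ρ) * Real.exp (3 * (1 / (2 + ρ)) * S)) * ENNReal.ofReal 1 :=
          mul_le_mul_right (lintegral_exp_neg_Icc_le hS) _
      _ = ENNReal.ofReal (A * D ^ (1 - 2 * ρ) * Real.exp (3 * (1 / (2 + ρ)) * S)) := by rw [ENNReal.ofReal_one, mul_one]
  -- conclude
  have hmain : volume {y ∈ Y₀ | ∃ σ ∈ Icc 0 S, L / 2 * Real.exp ((S - σ) / (2 + ρ)) ≤ ‖Φ (-σ) y‖} * ε ≤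
      ENNReal.ofReal (A * D ^ (1 - 2 * ρ) * Real.exp (3 * (1 / (2 + ρ)) * S)) := by
    rw [mul_comm]
    exact ((mul_le_mul_right hvol _).trans hcheb).trans htot
  have hdiv' : volume {y ∈ Y₀ | ∃ σ ∈ Icc 0 S, L / 2 * Real.exp ((S - σ) / (2 + ρ)) ≤ ‖Φ (-σ) y‖} ≤
      ENNReal.ofReal (A * D ^ (1 - 2 * ρ) * Real.exp (3 * (1 / (2 + ρ)) * S)) / ε :=
    (ENNReal.le_div_iff_mul_le (Or.inl hε0) (Or.inl ENNReal.ofReal_ne_top)).2 hmain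
  have hne : ENNReal.ofReal (A * D ^ (1 - 2 * ρ) * Real.exp (3 * (1 / (2 + ρ)) * S)) / ε ≠ ⊤ :=
    ENNReal.div_ne_top ENNReal.ofReal_ne_top hε0
  refine (ENNReal.toReal_mono hne hdiv').trans ?_
  rw [ENNReal.toReal_div, ENNReal.toReal_ofReal (by positivity), hε, ENNReal.toReal_ofReal (by positivity)]
  have hpow : D ^ (1 - 2 * ρ) / (D / 2) ^ 2 = 4 * D ^ (-(1 + 2 * ρ)) := by
    rw [show -(1 + 2 * ρ) = (1 - 2 * ρ) - 2 by ring, Real.rpow_sub hD0 (1 - 2 * ρ) 2, Real.rpow_two]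
    field_simp
    ring
  have e3 : Real.exp (3 * (1 / (2 + ρ)) * S) = Real.exp (3 * S / (2 + ρ)) := by congr 1; field_simp
  calc A * D ^ (1 - 2 * ρ) * Real.exp (3 * (1 / (2 + ρ)) * S) / (D / 2) ^ 2
      = A * (D ^ (1 - 2 * ρ) / (D / 2) ^ 2) * Real.exp (3 * (1 / (2 + ρ)) * S) := by ring
    _ = 4 * A * (L / 2) ^ (-(1 + 2 * ρ)) * Real.exp (3 * S / (2 + ρ)) := by rw [hpow, e3, hDdef]; ring
    _ ≤ 32 * A * L ^ (-(1 + 2 * ρ)) * Real.exp (3 * S / (2 + ρ)) :=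
        mul_le_mul_of_nonneg_right (inflow_constant hρ1 hA0 hL0) (Real.exp_pos _).le

end Summit.NavierStokesRegularity.NavierStokesRegularity.Theorems.PowerGaugeEulerLiouville.Trace
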